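import Mathlib
import Summits.QuantumAdvantage.QuantumAdvantage.Theorems.AbsorptionDialA
import Literature.Computability.MetaComplexity.SmolenskyHilbertHalf
import Literature.Computability.MetaComplexity.RazborovSmolenskyPoly

set_option linter.dupNamespace false

/-!
# AbsorptionDial (D) — the outer-parity degree cost of absorption is attained over every odd prime (cell decomp-qadv, lens 4, g14)

Prop-definition-free continuation of `AbsorptionDialA` (supports of item stmt-QuantumAdvantage-26994 ≡ 26767).
`hasDegF_parity` (part A) bounds the `𝔽_p`-degree of a parity of `m` Boolean functions of degree `≤ d` by `m·d`; that
bound is what forces the window schedule `k ≲ D/2d` behind the exchange rate `two_pow_le_losers_of_noPerfect` (part C):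
the absorbed window strategy pays `(k+q)·d` for the outer parity of the `k+q` slot outputs.  Here the bound is shown
TIGHT:

* `parityAnd m d` — the parity of `m` disjoint block-ANDs of `d` bits each (`blockAnd`, block coordinates `blk` via
  `finProdFinEquiv`); `hasDegF_blockAnd` — each block-AND has `𝔽_p`-degree `≤ d`; `hasDegF_parityAnd` — the parity has
  degree `≤ m·d`;
* `not_hasDegF_parityAnd` — for `p ≠ 2`, `m, d ≥ 1` it does NOT have degree `≤ m·d − 1`.  Proof: the alternating sum
  `Σ_u (−1)^{|u|}·[parityAnd u]`, which vanishes on `lowDeg (md − 1)` by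
  `Smolensky.sum_pmMono_univ_mul_eq_zero_of_mem_lowDeg`, equals `−(−2·(−1)^d)^m / 2 ≠ 0` in `𝔽_p`
  (`two_mul_ind_parityAnd`: `2·[parity] = 1 − Π_i (1 − 2[A_i])`; `pm_mul_prod_eq` + `blkEquiv` + `Fintype.sum_pow`:
  the character sum factorises over blocks; `sum_Gblk`: each block contributes `−2·(−1)^d`).

Over `𝔽₂` the same parity is free (degree `≤ d`) — the reason the `𝔽₂` cell's `ringWinU_fail_floor` pays nothing for
outer cuts — so the schedule of the `𝔽_p` exchange rate is intrinsic to restriction-to-subcube decoders.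

0 sorry; axioms standard; no `instance`, no `notation`, no `native_decide`.
-/

open Finset
open Literature.Computability.MetaComplexity Literature.Computability.MetaComplexity.Smolensky
open Summit.QuantumAdvantage.AdviceFreeQNC0

namespace Summit.QuantumAdvantage.QuantumAdvantage.Theorems.AbsorptionDial

variable {p : ℕ} [Fact p.Prime]

/-- block coordinates: bit `j` of block `i` of an input on `m * d` bits. -/
def blk (m d : ℕ) (u : Fin (m * d) → Bool) (i : Fin m) : Fin d → Bool := fun j => u (finProdFinEquiv (i, j))

/-- the AND of block `i`. -/
def blockAnd (m d : ℕ) (i : Fin m) (u : Fin (m * d) → Bool) : Bool := decide (∀ j : Fin d, blk m d u i j = true)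

/-- the parity of the `m` block-ANDs (the outer parity of `m` disjoint slot outputs of degree `d` each). -/
def parityAnd (m d : ℕ) (u : Fin (m * d) → Bool) : Bool :=
  decide (Odd (univ.filter fun i : Fin m => blockAnd m d i u = true).card)

/-- each block-AND has `𝔽_p`-degree `≤ d`. -/
theorem hasDegF_blockAnd (m d : ℕ) (i : Fin m) : HasDegF p (blockAnd m d i) d := by
  unfold HasDegF
  set S : Finset (Fin (m * d)) := univ.image fun j : Fin d => finProdFinEquiv (i, j) with hS
  have hcard : S.card ≤ d := by
    refine le_trans Finset.card_image_le ?_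
    rw [Finset.card_univ, Fintype.card_fin]
  have heq : (fun x : Fin (m * d) → Bool => if blockAnd m d i x = true then (1 : ZMod p) else 0) = mono (ZMod p) S := by
    funext x
    rw [mono_apply]
    have hiff : blockAnd m d i x = true ↔ ∀ y ∈ S, x y = true := by
      unfold blockAnd blk
      rw [decide_eq_true_eq]
      constructor
      · intro h y hy
        obtain ⟨j, -, rfl⟩ := Finset.mem_image.1 hy
        exact h j
      · intro h j
        exact h _ (Finset.mem_image.2 ⟨j, mem_univ _, rfl⟩)
    by_cases h : blockAnd m d i x = true
    · rw [if_pos h, if_pos (hiff.1 h)]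
    · rw [if_neg h, if_neg (fun h' => h (hiff.2 h'))]
  rw [heq]
  exact mono_mem_lowDeg hcard

/-- the per-block weight `G(v) = (Π_j (1 − 2 v_j)) · (1 − 2·[v = 1^d])`. -/
def Gblk (p d : ℕ) (v : Fin d → Bool) : ZMod p :=
  (∏ j : Fin d, (if v j then (-1 : ZMod p) else 1)) * (1 - 2 * (if (∀ j : Fin d, v j = true) then (1 : ZMod p) else 0))

/-- `Σ_v Π_j (1 − 2 v_j) = 0` for `d ≥ 1`. -/
theorem sum_prod_sign_eq_zero {d : ℕ} (hd : 1 ≤ d) :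
    ∑ v : Fin d → Bool, ∏ j : Fin d, (if v j then (-1 : ZMod p) else 1) = 0 := by
  rw [← Fintype.prod_sum (fun (j : Fin d) (b : Bool) => if b then (-1 : ZMod p) else 1)]
  have h0 : ∀ j : Fin d, (∑ b : Bool, if b then (-1 : ZMod p) else 1) = 0 := fun j => by
    rw [Fintype.sum_bool]; simp
  exact Finset.prod_eq_zero (mem_univ (⟨0, by omega⟩ : Fin d)) (h0 ⟨0, by omega⟩)

/-- `Σ_v G(v) = −2·(−1)^d` for `d ≥ 1`. -/
theorem sum_Gblk {d : ℕ} (hd : 1 ≤ d) : ∑ v : Fin d → Bool, Gblk p d v = -2 * (-1) ^ d := by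
  have hsplit : ∀ v : Fin d → Bool, Gblk p d v =
      (∏ j : Fin d, (if v j then (-1 : ZMod p) else 1)) -
        2 * ((∏ j : Fin d, (if v j then (-1 : ZMod p) else 1)) * (if (∀ j : Fin d, v j = true) then (1 : ZMod p) else 0)) := by
    intro v; unfold Gblk; ring
  rw [Finset.sum_congr rfl fun v _ => hsplit v, Finset.sum_sub_distrib, sum_prod_sign_eq_zero hd, ← Finset.mul_sum,
    Finset.sum_eq_single (fun _ : Fin d => true)]
  · simp
  · intro v _ hv
    have : ¬ (∀ j : Fin d, v j = true) := fun h => hv (funext h)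
    rw [if_neg this, mul_zero]
  · intro h; exact absurd (mem_univ _) h

/-- the reindexing `u ↦ blk m d u` is a bijection `(Fin (m d) → Bool) ≃ (Fin m → Fin d → Bool)`. -/
def blkEquiv (m d : ℕ) : (Fin (m * d) → Bool) ≃ (Fin m → Fin d → Bool) :=
  (Equiv.arrowCongr finProdFinEquiv.symm (Equiv.refl Bool)).trans (Equiv.curry (Fin m) (Fin d) Bool)

/-- AbsorptionDialD helper `blkEquiv_apply` (decomp-qadv land package; see the module docstring). -/
theorem blkEquiv_apply (m d : ℕ) (u : Fin (m * d) → Bool) : blkEquiv m d u = blk m d u := by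
  funext i j
  rfl

/-- pointwise: `ḡ(u) · Π_i (1 − 2[A_i u]) = Π_i G(blk u i)`. -/
theorem pm_mul_prod_eq (m d : ℕ) (u : Fin (m * d) → Bool) :
    pmMono (ZMod p) univ u * ∏ i : Fin m, (1 - 2 * (if blockAnd m d i u = true then (1 : ZMod p) else 0)) =
      ∏ i : Fin m, Gblk p d (blk m d u i) := by
  have hpm : pmMono (ZMod p) univ u = ∏ i : Fin m, ∏ j : Fin d, (if blk m d u i j then (-1 : ZMod p) else 1) := by
    unfold pmMono sgn
    rw [← Fintype.prod_prod_type', ← finProdFinEquiv.prod_comp]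
    rfl
  rw [hpm, ← Finset.prod_mul_distrib]
  refine Finset.prod_congr rfl fun i _ => ?_
  unfold Gblk blockAnd
  simp only [decide_eq_true_eq]

/-- pointwise: `2·[parity of the A_i] = 1 − Π_i (1 − 2[A_i])`. -/
theorem two_mul_ind_parityAnd (m d : ℕ) (u : Fin (m * d) → Bool) :
    2 * (if parityAnd m d u = true then (1 : ZMod p) else 0) =
      1 - ∏ i : Fin m, (1 - 2 * (if blockAnd m d i u = true then (1 : ZMod p) else 0)) := by
  have hprod : ∏ i : Fin m, (1 - 2 * (if blockAnd m d i u = true then (1 : ZMod p) else 0)) =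
      (-1) ^ (univ.filter fun i : Fin m => blockAnd m d i u = true).card := by
    have : ∀ i : Fin m, (1 - 2 * (if blockAnd m d i u = true then (1 : ZMod p) else 0)) =
        if blockAnd m d i u = true then (-1 : ZMod p) else 1 := fun i => by
      split_ifs <;> ring
    rw [Finset.prod_congr rfl fun i _ => this i, Finset.prod_ite, Finset.prod_const_one, mul_one, Finset.prod_const]
  rw [hprod]
  unfold parityAnd
  simp only [decide_eq_true_eq]
  rcases Nat.even_or_odd (univ.filter fun i : Fin m => blockAnd m d i u = true).card with he | ho
  · rw [if_neg (Nat.not_odd_iff_even.2 he), he.neg_one_pow]; ring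
  · rw [if_pos ho, ho.neg_one_pow]; ring

/-- `2 ≠ 0` in `𝔽_p` for an odd prime. -/
private theorem two_ne_zero_zmod (hp2 : p ≠ 2) : (2 : ZMod p) ≠ 0 := by
  intro h
  have h' : ((2 : ℕ) : ZMod p) = 0 := by exact_mod_cast h
  rw [ZMod.natCast_eq_zero_iff] at h'
  have := (Nat.prime_dvd_prime_iff_eq (Fact.out) Nat.prime_two).1 h'
  exact hp2 this

/-- **THE WALL.**  For an odd prime `p`, `m ≥ 1` blocks of `d ≥ 1` bits: the parity of the `m` block-ANDs is NOT of
`𝔽_p`-degree `≤ m·d − 1` (while each block-AND has degree `≤ d`, `hasDegF_blockAnd`, and the parity has degree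
`≤ m·d` by `hasDegF_parity`). -/
theorem not_hasDegF_parityAnd (hp2 : p ≠ 2) {m d : ℕ} (hm : 1 ≤ m) (hd : 1 ≤ d) :
    ¬ HasDegF p (parityAnd m d) (m * d - 1) := by
  intro h
  have hmd : 1 ≤ m * d := Nat.one_le_iff_ne_zero.2 (Nat.mul_ne_zero (by omega) (by omega))
  have hlt : m * d - 1 < m * d := by omega
  have h' : (fun x : Fin (m * d) → Bool => if parityAnd m d x = true then (1 : ZMod p) else 0) ∈
      lowDeg (ZMod p) (m * d) (m * d - 1) := h
  have hzero := sum_pmMono_univ_mul_eq_zero_of_mem_lowDeg hlt h'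
  -- `Σ ḡ = 0`
  have hone := sum_pmMono_univ_mul_eq_zero_of_mem_lowDeg (by omega : 0 < m * d)
    (one_mem_lowDeg (F := ZMod p) (n := m * d) 0)
  simp only [Pi.one_apply, mul_one] at hone
  -- the character sum
  have hT : ∑ u : Fin (m * d) → Bool, pmMono (ZMod p) univ u *
      ∏ i : Fin m, (1 - 2 * (if blockAnd m d i u = true then (1 : ZMod p) else 0)) = (-2 * (-1) ^ d) ^ m := by
    rw [Finset.sum_congr rfl fun u _ => pm_mul_prod_eq m d u]
    rw [Fintype.sum_equiv (blkEquiv m d) (fun u => ∏ i : Fin m, Gblk p d (blk m d u i))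
      (fun w => ∏ i : Fin m, Gblk p d (w i)) (fun u => by rw [blkEquiv_apply])]
    rw [← Fintype.sum_pow, sum_Gblk hd]
  -- combine: 2·Σ ḡ·ind = Σ ḡ − T = −T
  have hcomb : 2 * ∑ u : Fin (m * d) → Bool, pmMono (ZMod p) univ u *
      (if parityAnd m d u = true then (1 : ZMod p) else 0) = -((-2 * (-1) ^ d) ^ m) := by
    rw [Finset.mul_sum]
    have : ∀ u : Fin (m * d) → Bool, 2 * (pmMono (ZMod p) univ u * (if parityAnd m d u = true then (1 : ZMod p) else 0)) =
        pmMono (ZMod p) univ u - pmMono (ZMod p) univ u *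
          ∏ i : Fin m, (1 - 2 * (if blockAnd m d i u = true then (1 : ZMod p) else 0)) := fun u => by
      rw [mul_left_comm, two_mul_ind_parityAnd]; ring
    rw [Finset.sum_congr rfl fun u _ => this u, Finset.sum_sub_distrib, hone, hT, zero_sub]
  rw [hzero, mul_zero] at hcomb
  have hne : ((-2 : ZMod p) * (-1) ^ d) ^ m ≠ 0 := by
    refine pow_ne_zero _ (mul_ne_zero (neg_ne_zero.2 (two_ne_zero_zmod hp2)) (pow_ne_zero _ (neg_ne_zero.2 one_ne_zero)))
  exact hne (neg_eq_zero.1 hcomb.symm)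


/-- … and it HAS `𝔽_p`-degree `≤ m·d` (`hasDegF_parity`): the outer-parity cost is exactly `m·d`. -/
theorem hasDegF_parityAnd (m d : ℕ) : HasDegF p (parityAnd m d) (m * d) := by
  have h := hasDegF_parity (p := p) (univ : Finset (Fin m)) (fun i => blockAnd m d i) fun i _ => hasDegF_blockAnd m d i
  rw [Finset.card_univ, Fintype.card_fin] at h
  have heq : parityAnd m d = fun x => decide ((univ.filter fun i : Fin m => blockAnd m d i x = true).card % 2 = 1) := by
    funext x
    unfold parityAnd
    simp only [Nat.odd_iff]
  rw [heq]
  exact h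

end Summit.QuantumAdvantage.QuantumAdvantage.Theorems.AbsorptionDial
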